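import Summits.BirchSwinnertonDyer.BirchSwinnertonDyer.Theorems.ErratumRoadFiveBdvCalibrationSplitCalibratorDefs

/-!
# The BDV-calibration split of `A♭-fam` — the PROVED recomposition and its certificates (crux
# stmt-BirchSwinnertonDyer-19715, (α2) item stmt-BirchSwinnertonDyer-33169 `ErratumRoadFive.KatoValuationIneqNonsplitAtFive`;
# deliverable 1 of idea-9 g48, PORTED — this is the module the planner's registry r2 of `bstw_door.lean` imports)

BUILT port (LEAD `bsd-line-er5-p1` g18, SUMMON key `d1land`; pen g51, director-bsd (603) step (3); critic idea-crit-14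
V359 PASS; referee g87 PRE-VERIFY PASS) of the crux WORKFILE
`Cruxes/EulerHalfNotRamNoInertSetAtFive/Lines/bdv_calibration_split.lean` (32d3c462f2f9, sha256 `d7c111836b2083c2…`),
§2 (glue) and §4 (certificates); vocabulary in `ErratumRoadFiveBdvCalibrationSplitDefs` (S1 `BdvChainExplicitNonsplit`,
S2 `EisensteinPeriodRatioValuation`, `bdvExplicitExponent`, `bottomClass`, `AFlatFamStatement`) and
`ErratumRoadFiveBdvCalibrationSplitCalibratorDefs` (S2a/S2c/S2b).

* `katoBdpCrossingNonsplitFamily_of_bdvChain_of_calibration : BdvChainExplicitNonsplit →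
    (∀ p ≥ 5, ∀ admissible L, EisensteinPeriodRatioValuation L p) → A♭-fam` — PROVED: the calibrator's exact identity
  and S1's identity at the calibrator are two powers of `p` with exponents `e′` and `e′ − V p d_L`, so `V p d_L = 0`
  (`zpow_right_injective₀`); S1 at the target curve then gives `A♭-fam`, the `a_p`-term of `bdvExplicitExponent`
  vanishing at a non-split multiplicative prime because `a_p = −1` [KO92, Lemme 1] and `p ∤ p + 2` (`p ≥ 5`).
  Its conclusion is the registered open stub `BstwDoor.stub_katoBdpCrossingNonsplitFamily`
  (`Cruxes/KatoValuationIneqNonsplitAtFive/Lines/bstw_door.lean` 5666110a8ff7d20b l.782–832; referee raw-span sha16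
  `3129208a824270e1`) TOKEN FOR TOKEN — same binder order, same `bottomClass` body `layerZeroToTop W p K (I.proj 0 z₀)` —
  so the registry can discharge that stub by `exact katoBdpCrossingNonsplitFamily_of_bdvChain_of_calibration h₁ h₂`
  over two by-name stubs (critic's kernel certificate of record: concatenation probe `split_byname_cert.lean`, `rfl`).
* `aFlatFam_of_bdvChain_of_calibration`, `aFlatFam_of_bdvChain_of_supply_of_port` (three-piece corollary) and the
  anti-costume direction `bdvChainExplicitNonsplit_of_aFlatFam_of_port` (S1 ⟸ A♭-fam ∧ S2b, `V = 0`).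

Every theorem here is CONDITIONAL on the open constants it names (hypotheses, never asserted); nothing is booked;
typed ≠ proved; closes: none; no summit statement is touched; BSD is proved for no curve.
[BDV22] Bertolini–Darmon–Venerucci, Adv. Math. 398 (2022) 108172, §4 (38), Lemma 4.6.  [BSTW24] arXiv:2409.01350,
Thm 1.13, §6.2.1.  [KO92] Kraus–Oesterlé, Lemme 1 p. 262.
-/

set_option autoImplicit false
-- D-0017: single-problem summit, so `Summit.BirchSwinnertonDyer.BirchSwinnertonDyer.…` repeats a namespace BY DESIGN.
set_option linter.dupNamespace false

noncomputable section

open scoped Classical NumberField TensorProduct BigOperators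

namespace Summit.BirchSwinnertonDyer.BirchSwinnertonDyer.Theorems.ErratumRoadFiveBdvCalibrationSplit

open Field
open Literature.NumberTheory.GaloisRepresentations
open Literature.NumberTheory.EllipticCurves Literature.NumberTheory.EllipticCurves.Kato2004
open Literature.NumberTheory.EllipticCurves.Kato2004.EulerSystemValues
open Literature.NumberTheory.EllipticCurves.Rank1Residual
open Literature.NumberTheory.EllipticCurves.Rank1Residual.Typed
open Literature.NumberTheory.EllipticCurves.ModularForms
open Literature.NumberTheory.EllipticCurves.Castella2018
open Summit.BirchSwinnertonDyer.Rank1Residual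
open IsDedekindDomain (HeightOneSpectrum)
open CongruenceSubgroup (Gamma0)

/-! ## §2 (glue) The proved recomposition — conclusion = registered stub statement, token for token -/

/-- **The proved recomposition (deliverable 1, gate (i)).**  Conclusion = the statement of the registered open stub
`BstwDoor.stub_katoBdpCrossingNonsplitFamily` (bstw_door.lean 5666110a8ff7d20b l.782–832) TOKEN FOR TOKEN.
Proof: S2 at `(L, p)` yields a calibrator with exact exponent `e′`; S1 at the calibrator yields exponent
`e′ − V p d_L` for the same norm; `p^· ` is injective (`p > 1`), so `V p d_L = 0`; S1 at the target curve (a member of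
the class by `nonExceptionalRankOneAt_of_classX11b`) then gives the registered exponent once the `a_p`-term is
removed by `bdvExplicitExponent_of_not_split`. -/
theorem katoBdpCrossingNonsplitFamily_of_bdvChain_of_calibration
    (h₁ : BdvChainExplicitNonsplit)
    (h₂ : ∀ (p : ℕ) [Fact p.Prime], 5 ≤ p → ∀ (L : Type) [Field L] [NumberField L],
      IsImaginaryQuadratic L → SatisfiesHeegnerHypothesis p L → NumberField.discr L < -4 →
      Odd (NumberField.discr L) → EisensteinPeriodRatioValuation L p) :
    ∀ (W : WeierstrassCurve ℚ) [W.IsElliptic] [W.IsGloballyMinimal] (p : ℕ) [Fact p.Prime]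
      [ContinuousSMul ℤ_[p] (W.tateModule p)] [Module.Free ℤ_[p] (W.tateModule p)]
      [Module.Finite ℤ_[p] (W.tateModule p)] [NeZero (W.conductorNorm ℤ)],
      ClassX11b W p → 5 ≤ p → Surj W p → ¬ W.HasSplitMultiplicativeReductionAtPrime p →
      ∀ (L : Type) [Field L] [NumberField L], IsImaginaryQuadratic L →
        SatisfiesHeegnerHypothesis (W.conductorNorm ℤ) L → SatisfiesHeegnerHypothesis p L →
        NumberField.discr L < -4 → Odd (NumberField.discr L) →
        (W.quadraticTwist (NumberField.discr L : ℚ)).entireLFunction 1 ≠ 0 →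
      ∀ (Dt : ModularParametrizationData W (W.conductorNorm ℤ))
        (Hd : HeegnerDatum (W.conductorNorm ℤ) (NumberField.discr L)) (w₀ : NumberField.InfinitePlace L)
        (PL : (W.baseChange L).toAffine.Point),
        WeierstrassCurve.Affine.Point.map w₀.embedding.toRatAlgHom PL = heegnerPointComplex Dt Hd →
        ¬ (p : ℤ) ∣ Dt.c →
      ∀ (s : ℚ) (k : ℤ),
        (Real.sqrt ((NumberField.discr L).natAbs : ℝ) : ℂ) *
            (W.quadraticTwist (NumberField.discr L : ℚ)).entireLFunction 1 = (s : ℂ) * (minusPeriod Dt.f : ℂ) →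
        (Dt.c : ℝ) * minusPeriod Dt.f = k * W.imaginaryPeriodRat →
      ∀ (W' : WeierstrassCurve ℚ) [W'.IsElliptic] (D : ModularParametrizationData W' (W.conductorNorm ℤ)),
        D.f = Dt.f →
        (∀ (W'' : WeierstrassCurve ℚ) [W''.IsElliptic] (D'' : ModularParametrizationData W'' (W.conductorNorm ℤ)),
            D''.f = D.f → D.modularDegree ≤ D''.modularDegree) →
      ∀ (K : ZpExtension ℚ p) (hK : K.IsCyclotomic) (γ : absoluteGaloisGroup ℚ)
        (I : IwasawaH1Data W p K γ), K.IsTopGenerator γ →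
      ∀ (hp : p ≠ 2) (N : ℕ) [NeZero N] (f : CuspForm (Gamma0 N) 2), IsNewformOf W f →
      ∀ (ι : (n : ℕ) → (CyclotomicField n ℚ →+* ℂ)) (q : ℚ)
        (Λ : ∀ (m : ℕ) (r : Finset (HeightOneSpectrum (𝓞 ℚ))),
          H1 (tateRep W p) (cycSubgroup p m r) →ₗ[ℤ_[p]] ℚ_[p] ⊗[ℚ] CyclotomicField (cycLevel p m r) ℚ)
        (c d₁ a : ℤ) (A : ℕ) (d' : ℤ)
        (z : ∀ (m : ℕ) (r : (cyclotomicLevelsRat p (badPlaces c d₁ A N)).Ideals),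
          H1 (tateRep W p) ((cyclotomicLevelsRat p (badPlaces c d₁ A N)).level m r.1))
        (x : ∀ (m : ℕ) (r : (cyclotomicLevelsRat p (badPlaces c d₁ A N)).Ideals),
          CyclotomicField (cycLevel p m r.1) ℚ)
        (y : I.H) (perRatio : ℚ),
        q ≠ 0 → ZetaBody W p f ι ((q : ℚ) : ℝ) Λ c d₁ a A z x →
        (∀ n : ℕ, I.proj n y =
          levelToLayer W p hK hp (badPlaces c d₁ A N) n
            (z (n + 1) (cyclotomicLevelsRat p (badPlaces c d₁ A N)).idealOne)) →
        0 < A → Int.gcd c (6 * p * A) = 1 → Int.gcd d₁ (6 * p * N) = 1 → (d₁ : ℤ) * d' ≡ 1 [ZMOD (A : ℤ)] →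
        ratCuspFactor f true c d₁ a A d' ≠ 0 → perRatio ≠ 0 →
        plusPeriod f = ((perRatio : ℚ) : ℝ) * W.realPeriodRat →
      ∀ (ι' : PadicAlgCl p ≃+* ℂ)
        (κ : ZpExtension L p) (γ' : absoluteGaloisGroup L) (ΩK : ℂ) (Ωp : (unrIntegers p)ˣ) (Λf : UnrSeries p),
        κ.IsAnticyclotomic → κ.IsTopGenerator γ' → ΩK ≠ 0 →
        IsBDPLFunction ι' (X11b.primeOfEmbeddingDatum p ι' w₀.embedding) κ γ' Dt.f ΩK
          ((Ωp : unrIntegers p) : ℂ_[p]) Λf →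
      ∀ (X : ℂ_[p]), Λf.HasValueAt 0 X →
      ∀ σ : ℚ_[p], HasLocPKummerLog W p (bottomClass W p K I y) σ → σ ≠ 0 →
        ‖X‖ = (p : ℝ) ^ (1 + padicValInt p Dt.c - padicValRat p s - padicValInt p k -
            ((padicValNat p (congruenceNumber Dt.f) : ℤ) - padicValNat p D.modularDegree) -
            (σ.valuation + padicValRat p (perRatio /
              (q * ratCuspFactor f true c d₁ a A d' * ∏ ℓ ∈ A.primeFactors.erase p, eulerFactorAtOne W N ℓ)))) := by
  intro W _ _ p _ _ _ _ _ hX h5 hS hns L _ _ hLq hH hHp hd4 hodd hLt Dt Hd w₀ PL hPL hc s k hs hk W' _ D hDf hmin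
    K hK γ I hγ hp N _ f hf ι q Λ c d₁ a A d' z x y perRatio hq hzeta hy hA hcg hd hdd' hR hper0 hper
    ι' κ γ' ΩK Ωp Λf hκ hγ' hΩK hBDP X hXv σ hσ hσ0
  obtain ⟨V, hV⟩ := h₁
  have hp1 : (1 : ℝ) < p := by exact_mod_cast (Fact.out : p.Prime).one_lt
  have hp0 : (0 : ℝ) < p := lt_trans one_pos hp1
  -- Step 1: the calibrator at `(L, p)` pins `V p d_L = 0`.
  have hV0 : V p (NumberField.discr L) = 0 := by
    obtain ⟨W₁, hE₁, hGM₁, hCS₁, hMF₁, hMFi₁, hNZ₁, hrk₁, hirr₁, hgo₁, hS₁, hH₁, hLt₁, Dt₁, Hd₁, w₁, PL₁, hPL₁,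
      hc₁, s₁, k₁, hs₁, hk₁, W₁', hE₁', D₁, hDf₁, hmin₁, K₁, hK₁, γ₁, I₁, hγ₁, hp₁, N₁, hN₁, f₁, hf₁, ι₁, q₁, Λ₁,
      c₁, e₁, a₁, A₁, e₁', z₁, x₁, y₁, perRatio₁, hq₁, hzeta₁, hy₁, hA₁, hcg₁, hd₁, hdd₁, hR₁, hper0₁, hper₁,
      ι₁', κ₁, γ₁', ΩK₁, Ωp₁, Λf₁, hκ₁, hγ₁', hΩK₁, hBDP₁, X₁, hXv₁, σ₁, hσ₁, hσ0₁, hnorm₁⟩ :=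
      h₂ p h5 L hLq hHp hd4 hodd
    have h := hV W₁ p ⟨hrk₁, hirr₁, Or.inr hgo₁⟩ h5 hS₁ L hLq hH₁ hHp hd4 hodd hLt₁ Dt₁ Hd₁ w₁ PL₁ hPL₁ hc₁
      s₁ k₁ hs₁ hk₁ W₁' D₁ hDf₁ hmin₁ K₁ hK₁ γ₁ I₁ hγ₁ hp₁ N₁ f₁ hf₁ ι₁ q₁ Λ₁ c₁ e₁ a₁ A₁ e₁' z₁ x₁ y₁
      perRatio₁ hq₁ hzeta₁ hy₁ hA₁ hcg₁ hd₁ hdd₁ hR₁ hper0₁ hper₁ ι₁' κ₁ γ₁' ΩK₁ Ωp₁ Λf₁ hκ₁ hγ₁' hΩK₁ hBDP₁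
      X₁ hXv₁ σ₁ hσ₁ hσ0₁
    rw [hnorm₁] at h
    have he := zpow_right_injective₀ hp0 hp1.ne' h
    omega
  -- Step 2: S1 at the target curve, with `V p d_L = 0` and `a_p = −1`.
  have h := hV W p (nonExceptionalRankOneAt_of_classX11b W p hX hns) h5 hS L hLq hH hHp hd4 hodd hLt Dt Hd w₀
    PL hPL hc s k hs hk W' D hDf hmin K hK γ I hγ hp N f hf ι q Λ c d₁ a A d' z x y perRatio hq hzeta hy hA hcg
    hd hdd' hR hper0 hper ι' κ γ' ΩK Ωp Λf hκ hγ' hΩK hBDP X hXv σ hσ hσ0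
  rw [hV0, sub_zero, bdvExplicitExponent_of_not_split W p hX.2.2.1 hns h5] at h
  exact h


/-! ## §4 Certificates: the three-piece corollary and `S1 ⟸ A♭-fam ∧ S2b` -/

/-- `S1 ∧ (∀ admissible (L,p), S2) ⟹ A♭-fam` with the conclusion folded into the named `Prop` `AFlatFamStatement`. -/
theorem aFlatFam_of_bdvChain_of_calibration (h₁ : BdvChainExplicitNonsplit)
    (h₂ : ∀ (p : ℕ) [Fact p.Prime], 5 ≤ p → ∀ (L : Type) [Field L] [NumberField L],
      IsImaginaryQuadratic L → SatisfiesHeegnerHypothesis p L → NumberField.discr L < -4 →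
      Odd (NumberField.discr L) → EisensteinPeriodRatioValuation L p) :
    AFlatFamStatement := by
  unfold AFlatFamStatement
  exact katoBdpCrossingNonsplitFamily_of_bdvChain_of_calibration h₁ h₂

/-- The three-piece corollary: S1 ∧ (supply at every admissible `(L,p)`) ∧ S2c ∧ S2b ⟹ `A♭-fam`. -/
theorem aFlatFam_of_bdvChain_of_supply_of_port (h₁ : BdvChainExplicitNonsplit)
    (hsup : ∀ (p : ℕ) [Fact p.Prime], 5 ≤ p → ∀ (L : Type) [Field L] [NumberField L],
      IsImaginaryQuadratic L → SatisfiesHeegnerHypothesis p L → NumberField.discr L < -4 →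
      Odd (NumberField.discr L) → CalibratorSupply L p)
    (hreal : CalibratorDataRealisable) (hport : BstwIntegralPerrinRiouGoodOrdinary) : AFlatFamStatement :=
  aFlatFam_of_bdvChain_of_calibration h₁ (fun p _ h5 L _ _ hLq hHp hd4 hodd =>
    eisensteinPeriodRatioValuation_of_supply_of_port p h5 L hLq hHp hd4 hodd (hsup p h5 L hLq hHp hd4 hodd)
      hreal hport)

/-- Anti-costume certificate, one direction: S1 is IMPLIED by `A♭-fam ∧ S2b` (take `V = 0`).  (It implies neither:
S1 alone fixes no value of `V`.) -/
theorem bdvChainExplicitNonsplit_of_aFlatFam_of_port (hA : AFlatFamStatement)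
    (hport : BstwIntegralPerrinRiouGoodOrdinary) : BdvChainExplicitNonsplit := by
  refine ⟨fun _ _ => 0, ?_⟩
  intro W _ _ p _ _ _ _ _ hcls h5 hS L _ _ hLq hH hHp hd4 hodd hLt Dt Hd w₀ PL hPL hc s k hs hk W' _ D hDf hmin
    K hK γ I hγ hp N _ f hf ι q Λ c d₁ a A d' z x y perRatio hq hzeta hy hA0 hcg hd hdd' hR hper0 hper
    ι' κ γ' ΩK Ωp Λf hκ hγ' hΩK hBDP X hXv σ hσ hσ0
  simp only [sub_zero]
  rcases hcls with ⟨hrk, hirr, hmult | hgo⟩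
  · have hp2 : p ≠ 2 := by omega
    have h := hA W p ⟨hrk, hp2, hmult.1, hirr⟩ h5 hS hmult.2 L hLq hH hHp hd4 hodd hLt Dt Hd w₀ PL hPL hc s k
      hs hk W' D hDf hmin K hK γ I hγ hp N f hf ι q Λ c d₁ a A d' z x y perRatio hq hzeta hy hA0 hcg hd hdd' hR
      hper0 hper ι' κ γ' ΩK Ωp Λf hκ hγ' hΩK hBDP X hXv σ hσ hσ0
    rw [bdvExplicitExponent_of_not_split W p hmult.1 hmult.2 h5]
    exact h
  · exact hport W p hrk hirr hgo h5 hS L hLq hH hHp hd4 hodd hLt Dt Hd w₀ PL hPL hc s k hs hk W' D hDf hmin K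
      hK γ I hγ hp N f hf ι q Λ c d₁ a A d' z x y perRatio hq hzeta hy hA0 hcg hd hdd' hR hper0 hper ι' κ γ' ΩK
      Ωp Λf hκ hγ' hΩK hBDP X hXv σ hσ hσ0

end Summit.BirchSwinnertonDyer.BirchSwinnertonDyer.Theorems.ErratumRoadFiveBdvCalibrationSplit

end
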